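import Literature.NumberTheory.EllipticCurves.IwasawaAlgebraStructureProofs
import Literature.NumberTheory.EllipticCurves.IwasawaAlgebraPseudoNullProofs
import Literature.NumberTheory.EllipticCurves.IwasawaAlgebraCharIdealProofs
import Mathlib.LinearAlgebra.FreeModule.ModN
import HarnessLib

/-!
# `X/pX` finite ⇒ `μ(X) = 0` for a finitely generated torsion `Λ`-module (the `μ`-half of
# Greenberg–Vatsal 2000, Prop. (2.8): "`S^{Σ₀}_A(ℚ_∞)` is `Λ`-cotorsion and has `μ`-invariant `0`
# if and only if `S^{Σ₀}_A(ℚ_∞)[π]` is finite")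

HONEST FRAMING (BSD rank-`≤ 1` residual cell `b2b-bsdres`, home
`run/shared/lean/b2b/bsd-rank1-residual/`, unit `b2b-bsdres-eisenstein-p2`, class X2; research route,
no claim beyond stated classes): the cell deletes the COMBINATION-SHAPED residual classes of the
rank-`≤ 1` BSD formula from PUBLISHED theorems only and TYPES the construction-shaped ones; this is
not "finishing BSD". PURE ALGEBRA, theorems only (no definition, no named fact): for a finitely
generated torsion module `X` over the Iwasawa algebra `Λ = ℤ_p⟦T⟧`,

  **`muInvariant_eq_zero_of_finite_modN`**: if `X/pX` is finite then `μ(X) = 0`.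

(Converse direction of use: `μ(X) = 0 ⇒ X` f.g. over `ℤ_p ⇒ X/pX` finite is the tree's
`muInvariant_eq_zero_iff_finite`.) Proof from the tree's STRUCTURE THEOREM
(`exists_isPseudoIsomorphism_elementary_holds`: `f : X → E = ⨁ Λ/(p^{μᵢ}) ⊕ ⨁ Λ/(fⱼ^{nⱼ})` with
finite kernel and cokernel, all `μᵢ ≥ 1`) and `muInvariant_eq_sum_holds` (`μ(X) = Σ μᵢ`): if some
`μᵢ` occurred, the surjection `g : E → Λ/(p^{μᵢ}) → Λ/(p)` kills `pE`, so `Λ/(p)` would be an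
extension of a quotient of the finite `coker f` by the image of the finite `X/pX` — but
`Λ/(p) = 𝔽_p⟦T⟧` is infinite (`infinite_quotient_span_C_p`: the classes of `T^n` are distinct).

Consumer: `X2/MuTransferDerived.lean` — the `μ`-half of Greenberg–Vatsal's Thm. (1.4) in the
kernel ("if `μ^{alg}_{E₁} = 0` then `μ^{alg}_{E₂} = 0`" for `E₁[p] ≅ E₂[p]`, p. 27), via Pontryagin
duality `X^{Σ₀}/p ↪ Hom(Sel^{Σ₀}[p], ℚ/ℤ)`.

References: R. Greenberg, V. Vatsal, Invent. Math. 142 (2000), Prop. (2.8) p. 25 ("Obviously,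
`S^{Σ₀}_A(ℚ_∞)` is `Λ`-cotorsion and has `μ`-invariant `0` if and only if `S^{Σ₀}_A(ℚ_∞)[π]` is
finite"); L. Washington, *Introduction to Cyclotomic Fields*, §13.2 (Thm. 13.12).
-/

noncomputable section

open scoped Classical DirectSum

universe u

namespace Summit.BirchSwinnertonDyer.Rank1Residual.X2.MuVanishingOfFiniteModP

open Literature.NumberTheory.EllipticCurves Literature.NumberTheory.EllipticCurves.IwasawaAlgebra
  PowerSeries

variable (p : ℕ) [hp : Fact p.Prime]

/-! ## §1. `Λ/(p) = 𝔽_p⟦T⟧` is infinite -/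

/-- **`Λ/(p)` is infinite**: the classes of `T^n`, `n ∈ ℕ`, are pairwise distinct (if
`T^a − T^b = c · p` then comparing the `T^a`-coefficients gives `1 = p · c_a` in `ℤ_p`, but `p` is
not a unit). [folklore] -/
theorem infinite_quotient_span_C_p :
    Infinite (IwasawaAlgebra p ⧸ Ideal.span {(C (p : ℤ_[p]) : IwasawaAlgebra p)}) := by
  refine Infinite.of_injective
    (fun n : ℕ ↦ Ideal.Quotient.mk (Ideal.span {(C (p : ℤ_[p]) : IwasawaAlgebra p)})
      ((X : IwasawaAlgebra p) ^ n)) fun a b hab ↦ ?_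
  by_contra hne
  have hmem : (X : IwasawaAlgebra p) ^ a - X ^ b ∈
      Ideal.span {(C (p : ℤ_[p]) : IwasawaAlgebra p)} := by
    rw [← Ideal.Quotient.eq]
    exact hab
  obtain ⟨c, hc⟩ := Ideal.mem_span_singleton'.mp hmem
  have hcoeff := congrArg (coeff a) hc
  rw [map_sub, coeff_X_pow, coeff_X_pow, if_pos rfl, if_neg hne, sub_zero, coeff_mul_C] at hcoeff
  exact (PadicInt.irreducible_p (p := p)).not_isUnit (IsUnit.of_mul_eq_one_right _ hcoeff)

/-- In `Λ/(p)` every element is killed by `p`. [folklore] -/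
theorem nsmul_p_quotient_span_C_p
    (q : IwasawaAlgebra p ⧸ Ideal.span {(C (p : ℤ_[p]) : IwasawaAlgebra p)}) : p • q = 0 := by
  obtain ⟨x, rfl⟩ := Ideal.Quotient.mk_surjective q
  rw [← map_nsmul, Ideal.Quotient.eq_zero_iff_mem, nsmul_eq_mul, ← map_natCast (C (R := ℤ_[p])) p]
  exact Ideal.mul_mem_right _ _ (Ideal.mem_span_singleton_self _)

/-! ## §2. `X/pX` finite ⇒ `μ(X) = 0` -/

/-- A module `Q` with a submodule `N` such that `N` and `Q/N` are finite is finite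
(`#Q = #N · #(Q/N)`). [folklore] -/
theorem finite_of_finite_submodule_of_finite_quotient {R : Type*} [Ring R] {Q : Type*}
    [AddCommGroup Q] [Module R Q] (N : Submodule R Q) [Finite N] [Finite (Q ⧸ N)] : Finite Q := by
  apply Nat.finite_of_card_ne_zero
  rw [Submodule.card_eq_card_quotient_mul_card N]
  exact mul_ne_zero Nat.card_pos.ne' Nat.card_pos.ne'

/-- **`X/pX` finite ⇒ `μ(X) = 0`** for a finitely generated torsion `Λ`-module `X` (`X/pX` as the
group quotient `ModN X p = X/p·X`). Washington §13.2 / GV Prop. (2.8) (the `μ`-half), from the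
structure theorem: a summand `Λ/(p^m)`, `m ≥ 1`, of the elementary model would make the infinite
`Λ/(p)` an extension of a quotient of the finite cokernel by an image of the finite `X/pX`.
[cite: GreenbergVatsal2000, §2 Prop. (2.8) (p. 25)] -/
theorem muInvariant_eq_zero_of_finite_modN (M : Type u) [AddCommGroup M]
    [Module (IwasawaAlgebra p) M] [Module.Finite (IwasawaAlgebra p) M]
    (hM : Module.IsTorsion (IwasawaAlgebra p) M) [hfin : Finite (ModN M p)] :
    muInvariant p M = 0 := by
  obtain ⟨μs, fs, hμpos, hfs, f, hkerf, hcokerf⟩ :=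
    exists_isPseudoIsomorphism_elementary_holds p M hM
  rw [muInvariant_eq_sum_holds p M (fun g hg ↦ (hfs g hg).1) ⟨f, hkerf, hcokerf⟩]
  -- it suffices that `μs` is empty
  by_contra hsum
  have hlen : 0 < μs.length := by
    rcases μs with _ | ⟨m, tl⟩
    · exact absurd List.sum_nil hsum
    · exact Nat.succ_pos _
  set i : Fin μs.length := ⟨0, hlen⟩ with hi
  have hm : 0 < μs.get i := hμpos _ (List.get_mem μs i)
  -- the pieces of the elementary module
  let E₁ := ⨁ k : Fin μs.length,
    IwasawaAlgebra p ⧸ Ideal.span {PowerSeries.C ((p : ℤ_[p]) ^ μs.get k)}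
  let E₂ := ⨁ j : Fin fs.length,
    IwasawaAlgebra p ⧸ Ideal.span {((fs.get j).1 : IwasawaAlgebra p) ^ (fs.get j).2}
  -- the target `Λ/(p)` and the surjection `g : E → Λ/(p^{μ_i}) → Λ/(p)`
  let I : Ideal (IwasawaAlgebra p) := Ideal.span {PowerSeries.C ((p : ℤ_[p]) ^ μs.get i)}
  let J : Ideal (IwasawaAlgebra p) := Ideal.span {(C (p : ℤ_[p]) : IwasawaAlgebra p)}
  have hIJ : I ≤ J := by
    refine Ideal.span_singleton_le_span_singleton.mpr ⟨C ((p : ℤ_[p]) ^ (μs.get i - 1)), ?_⟩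
    rw [← map_mul, ← pow_succ', Nat.sub_add_cancel hm]
  let π : elementaryModule p μs fs →ₗ[IwasawaAlgebra p] IwasawaAlgebra p ⧸ I :=
    (DirectSum.component (IwasawaAlgebra p) (Fin μs.length)
      (fun k : Fin μs.length ↦
        IwasawaAlgebra p ⧸ Ideal.span {PowerSeries.C ((p : ℤ_[p]) ^ μs.get k)}) i) ∘ₗ
      LinearMap.fst (IwasawaAlgebra p) E₁ E₂
  let ρ : (IwasawaAlgebra p ⧸ I) →ₗ[IwasawaAlgebra p] IwasawaAlgebra p ⧸ J :=
    Submodule.mapQ I J LinearMap.id (by simpa using hIJ)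
  let g : elementaryModule p μs fs →ₗ[IwasawaAlgebra p] IwasawaAlgebra p ⧸ J := ρ ∘ₗ π
  have hπ : Function.Surjective π := by
    intro q
    refine ⟨(show elementaryModule p μs fs from
      (DirectSum.lof (IwasawaAlgebra p) (Fin μs.length)
        (fun k : Fin μs.length ↦
        IwasawaAlgebra p ⧸ Ideal.span {PowerSeries.C ((p : ℤ_[p]) ^ μs.get k)}) i q, (0 : E₂))), ?_⟩
    change DirectSum.component (IwasawaAlgebra p) (Fin μs.length)
      (fun k : Fin μs.length ↦
        IwasawaAlgebra p ⧸ Ideal.span {PowerSeries.C ((p : ℤ_[p]) ^ μs.get k)}) i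
      (DirectSum.lof (IwasawaAlgebra p) (Fin μs.length)
        (fun k : Fin μs.length ↦
        IwasawaAlgebra p ⧸ Ideal.span {PowerSeries.C ((p : ℤ_[p]) ^ μs.get k)}) i q) = q
    exact DirectSum.component.lof_self (IwasawaAlgebra p)
      (M := fun k : Fin μs.length ↦
        IwasawaAlgebra p ⧸ Ideal.span {PowerSeries.C ((p : ℤ_[p]) ^ μs.get k)}) i q
  have hρ : Function.Surjective ρ := by
    intro q
    obtain ⟨x, rfl⟩ := Submodule.Quotient.mk_surjective J q
    exact ⟨Submodule.Quotient.mk x, rfl⟩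
  have hg : Function.Surjective g := hρ.comp hπ
  -- `g` kills `p · E`
  have hgp : ∀ e : elementaryModule p μs fs, g (p • e) = 0 := fun e ↦ by
    rw [map_nsmul]
    exact nsmul_p_quotient_span_C_p p (g e)
  -- `N = g(f(M))` is finite: it is the image of the finite group `M/pM`
  let N : Submodule (IwasawaAlgebra p) (IwasawaAlgebra p ⧸ J) := LinearMap.range (g ∘ₗ f)
  let h : ModN M p →+ IwasawaAlgebra p ⧸ J :=
    ModN.liftEquiv.symm ⟨((g ∘ₗ f).restrictScalars ℤ).toAddMonoidHom, fun m ↦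
      nsmul_p_quotient_span_C_p p _⟩
  have hh : ∀ m : M, h (ModN.mkQ p m) = g (f m) := fun _ ↦ rfl
  haveI : Finite N := by
    refine Finite.of_surjective (fun q : ModN M p ↦ (⟨h q, ?_⟩ : N)) ?_
    · obtain ⟨m, rfl⟩ := Submodule.mkQ_surjective _ q
      exact ⟨m, (hh m).symm⟩
    · rintro ⟨y, m, rfl⟩
      exact ⟨ModN.mkQ p m, Subtype.ext (hh m)⟩
  -- `Λ/(p) / N` is a quotient of the pseudo-null (= finite) `coker f`, hence finite
  haveI : Finite ((IwasawaAlgebra p ⧸ J) ⧸ N) := by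
    let gbar : (elementaryModule p μs fs ⧸ LinearMap.range f) →ₗ[IwasawaAlgebra p]
        (IwasawaAlgebra p ⧸ J) ⧸ N :=
      (LinearMap.range f).mapQ N g (by
        rintro e ⟨m, rfl⟩
        exact ⟨m, rfl⟩)
    have hgbar : Function.Surjective gbar := fun q ↦ by
      obtain ⟨y, rfl⟩ := Submodule.Quotient.mk_surjective N q
      obtain ⟨e, rfl⟩ := hg y
      exact ⟨Submodule.Quotient.mk e, rfl⟩
    exact finite_of_isPseudoNull p _ (Module.IsPseudoNull.of_surjective hcokerf gbar hgbar)
  haveI : Finite (IwasawaAlgebra p ⧸ J) := finite_of_finite_submodule_of_finite_quotient N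
  exact (infinite_quotient_span_C_p p).not_finite ‹_›

/-- Variant with the hypothesis as a `Finite` argument rather than an instance. [folklore] -/
theorem muInvariant_eq_zero_of_finite_modN' (M : Type u) [AddCommGroup M]
    [Module (IwasawaAlgebra p) M] [Module.Finite (IwasawaAlgebra p) M]
    (hM : Module.IsTorsion (IwasawaAlgebra p) M) (hfin : Finite (ModN M p)) :
    muInvariant p M = 0 :=
  muInvariant_eq_zero_of_finite_modN p M hM

end Summit.BirchSwinnertonDyer.Rank1Residual.X2.MuVanishingOfFiniteModP

end
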